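import Mathlib
import Summits.Ventures.PercRepro2.Defs
import Summits.Ventures.PercRepro2.Harris
import Summits.Ventures.PercRepro2.CoinDefs
import Summits.Ventures.PercRepro2.CoinStarDefs
import Summits.Ventures.PercRepro2.CoinLsmCoreDefs
import Summits.Ventures.PercRepro2.CoinLsmCoreU
import Summits.Ventures.PercRepro2.CoinCoreGate
import Summits.Ventures.PercRepro2.CoinOrTailKDefs
import Summits.Ventures.PercRepro2.CoinOrTailKSums
import Summits.Ventures.PercRepro2.CoinOrTailLsmCore
import Summits.Ventures.PercRepro2.CoinTreeCore
import Summits.Ventures.PercRepro2.CoinKSureCore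
import Summits.Ventures.PercRepro2.CoinKSureTailSums
import Summits.Ventures.PercRepro2.CoinKSureGen

import Summits.Ventures.PercRepro2.CoinKSureCloseStar
import Summits.Ventures.PercRepro2.CoinKSureTwoLevel
/-!
# Row 2′DARC at an OR-tail with a marker at a SECOND sure OR-vertex of the head (blind cell
PercRepro2, night-2 g15; proofs/NIGHT2-DARC.md §53)

Besides the OR-tail `a` (entries `ent ⊆ U`, sure coins) let `b` be a second OR-vertex, entered
ONLY from `entb ⊆ U` by SURE single-arc coins and with arbitrary out-arcs into the head
(`OrTailK arcs s (insert a U) entb d b` with `a ∉ entb`).  Then `Y = 1[b ∈ S⁺] = 1[W ∩ entb ≠ ∅]`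
is an increasing function of the core level and the head seen from the level is the OR-closure
`closeB entb b A`; the two level reductions (`CoinKSureTwoLevel`) bring the functional to the
§49 product form with the `b`-erased closure `closeBE entb b A` (nonnegative, decreasing,
log-supermodular) and `orTailKSure_functional_nonneg_markers` closes:
`darc_of_orTailKSure_markerB` (markers `(m, b)`, `m ∈ U`), `darc_of_orTailKSure_markerB'`
(`(b, m)`).
-/

namespace Summit.Ventures.PercRepro2.Coin

open Classical

section MarkerB

variable {V : Type*} {E : Type*} [Fintype V] [DecidableEq V] [Fintype E] [DecidableEq E]
  {R : Type*} [Field R] [LinearOrder R] [IsStrictOrderedRing R]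
  {arcs : E → Finset (V × V)} {s : V} {U : Finset V} {ent : Finset V} {c : V → E} {a w : V}
  {entb : Finset V} {d : V → E} {b : V}

/-- **THEOREM (row 2′DARC at an OR-tail, a marker at a SECOND sure OR-vertex of the head).**
`OrTailK arcs s U ent c a` with sure entry coins, a second OR-vertex `b` entered only from
`entb ⊆ U` by sure coins (`OrTailK arcs s (insert a U) entb d b`, `a ∉ entb`), `SameEnds`, the
cluster law of `U` log-supermodular, the markers `m ∈ U` and `b`, every head, every probability
vector: `DARC pr arcs s {t} m b a w`. -/
theorem darc_of_orTailKSure_markerB (pr : E → R) (hp : IsProbVec pr) (hS : SameEnds arcs)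
    (h : OrTailK arcs s U ent c a) (hb : OrTailK arcs s (insert a U) entb d b) (hae : a ∉ entb)
    {m : V} (hm : m ∈ U) (hsure : ∀ r ∈ ent, pr (c r) = 1) (hsureb : ∀ r ∈ entb, pr (d r) = 1)
    (hν : ∀ W W', W ⊆ U → W' ⊆ U →
      prob pr (coreLevel arcs s U W) * prob pr (coreLevel arcs s U W') ≤
        prob pr (coreLevel arcs s U (W ∩ W')) * prob pr (coreLevel arcs s U (W ∪ W')))
    {t : V} (htC : t ∉ insert b (insert a U)) (hts : t ≠ s) (hws : w ≠ s)
    (hwC : w ∉ insert b (insert a U)) :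
    DARC pr arcs s {t} m b a w := by
  have hC := hb.closedInCoreU
  have hba : b ≠ a := fun e => hb.a_notin (e ▸ Finset.mem_insert_self a U)
  have hbU : b ∉ U := fun hbU => hb.a_notin (Finset.mem_insert_of_mem hbU)
  have hmb : m ≠ b := fun e => hbU (e ▸ hm)
  have hma : m ≠ a := fun e => h.a_notin (e ▸ hm)
  have hmC : m ∈ insert b (insert a U) :=
    Finset.mem_insert_of_mem (Finset.mem_insert_of_mem hm)
  have hbC : b ∈ insert b (insert a U) := Finset.mem_insert_self _ _
  have haC : a ∈ insert b (insert a U) := Finset.mem_insert_of_mem (Finset.mem_insert_self _ _)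
  have hwe : w ∉ entb := fun hw => hwC (Finset.mem_insert_of_mem (hb.ent_sub hw))
  have hbw : b ≠ w := fun e => hwC (e ▸ hbC)
  unfold DARC
  rw [hC.phiC_gate_eq pr hS htC hts hmC hbC haC hws hwC]
  set A : Finset V → R := fun X => prob pr (coreAvoidEvent arcs s t (insert b (insert a U)) X)
    with hAdef
  set ν : Finset V → R := fun W => prob pr (coreLevel arcs s U W) with hνdef
  -- the marker functions and their invariances
  have hm1b : ∀ W : Finset V, (fun _ : Finset V => (1 : R)) (insert b W) = (fun _ => (1 : R)) W :=
    fun _ => rfl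
  have hm1a : ∀ W : Finset V, (fun _ : Finset V => (1 : R)) (insert a W) = (fun _ => (1 : R)) W :=
    fun _ => rfl
  have hmmb : ∀ W : Finset V, (fun W : Finset V => if m ∈ W then (1 : R) else 0) (insert b W) =
      (fun W : Finset V => if m ∈ W then (1 : R) else 0) W := by
    intro W; simp only [Finset.mem_insert, hmb, false_or]
  have hmma : ∀ W : Finset V, (fun W : Finset V => if m ∈ W then (1 : R) else 0) (insert a W) =
      (fun W : Finset V => if m ∈ W then (1 : R) else 0) W := by
    intro W; simp only [Finset.mem_insert, hma, false_or]
  have hgb0 : ∀ W : Finset V, b ∉ W → (fun W : Finset V => if b ∈ W then (1 : R) else 0) W = 0 := by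
    intro W hbW; simp only [hbW, if_false]
  have hgb1 : ∀ W : Finset V, b ∉ W →
      (fun W : Finset V => if b ∈ W then (1 : R) else 0) (insert b W) = (fun _ => (1 : R)) W := by
    intro W _; simp only [Finset.mem_insert_self, if_true]
  have hgq0 : ∀ W : Finset V, b ∉ W →
      (fun W : Finset V => (if m ∈ W then (1 : R) else 0) * (if b ∈ W then (1 : R) else 0)) W = 0 := by
    intro W hbW; simp only [hbW, if_false, mul_zero]
  have hgq1 : ∀ W : Finset V, b ∉ W →
      (fun W : Finset V => (if m ∈ W then (1 : R) else 0) * (if b ∈ W then (1 : R) else 0))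
          (insert b W) =
        (fun W : Finset V => if m ∈ W then (1 : R) else 0) W := by
    intro W _
    simp only [Finset.mem_insert_self, if_true, mul_one, Finset.mem_insert, hmb, false_or]
  -- the seven sums after the two level reductions
  have eΛ := two_level_R h hb pr hsureb A (fun _ => (1 : R)) hm1b hm1a
  have eΛm := two_level_R h hb pr hsureb A (fun W => if m ∈ W then (1 : R) else 0) hmmb hmma
  have eΛb := two_level_R_tail h hb hae pr hsureb A (fun W => if b ∈ W then (1 : R) else 0)
    (fun _ => (1 : R)) hgb0 hgb1 hm1a
  have eM := two_level_G h hb hae hwe hba pr hsureb A (fun _ => (1 : R)) hm1b hm1a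
  have eMm := two_level_G h hb hae hwe hba pr hsureb A (fun W => if m ∈ W then (1 : R) else 0)
    hmmb hmma
  have eMb := two_level_G_tail h hb hae hwe hba pr hsureb A
    (fun W => if b ∈ W then (1 : R) else 0) (fun _ => (1 : R)) hgb0 hgb1 hm1a
  have eMmb := two_level_G_tail h hb hae hwe hba pr hsureb A
    (fun W => (if m ∈ W then (1 : R) else 0) * (if b ∈ W then (1 : R) else 0))
    (fun W => if m ∈ W then (1 : R) else 0) hgq0 hgq1 hmma
  simp only [mul_one] at eΛ eΛb eM eMb
  rw [eΛ, eΛm, eΛb, eM, eMm, eMb, eMmb]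
  -- the `b`-erased head (log-supermodular on all sets) agrees with `closeB` on the core levels
  have hbW : ∀ W ∈ U.powerset, b ∉ W := fun W hW hbW => hbU (Finset.mem_powerset.1 hW hbW)
  have c1 : ∑ x ∈ U.powerset, prob pr (coreLevel arcs s U x) * rValK (closeB entb b A) pr ent c a x =
      ∑ x ∈ U.powerset, prob pr (coreLevel arcs s U x) * rValK (closeBE entb b A) pr ent c a x :=
    Finset.sum_congr rfl fun W hW => by rw [rValK_closeBE A pr (hbW W hW) hba]
  have c2 : (∑ W ∈ U.powerset, prob pr (coreLevel arcs s U W) * rValK (closeB entb b A) pr ent c a W *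
      if m ∈ W then (1 : R) else 0) =
      ∑ W ∈ U.powerset, prob pr (coreLevel arcs s U W) * rValK (closeBE entb b A) pr ent c a W *
        if m ∈ W then (1 : R) else 0 :=
    Finset.sum_congr rfl fun W hW => by rw [rValK_closeBE A pr (hbW W hW) hba]
  have c3 : ∑ x ∈ U.powerset, prob pr (coreLevel arcs s U x) * rValK (closeB entb b A) pr ent c a x *
      entInd entb x =
      ∑ x ∈ U.powerset, prob pr (coreLevel arcs s U x) * rValK (closeBE entb b A) pr ent c a x *
        entInd entb x :=
    Finset.sum_congr rfl fun W hW => by rw [rValK_closeBE A pr (hbW W hW) hba]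
  have c4 : ∑ x ∈ U.powerset, prob pr (coreLevel arcs s U x) * gValK (closeB entb b A) pr ent c a w x =
      ∑ x ∈ U.powerset, prob pr (coreLevel arcs s U x) * gValK (closeBE entb b A) pr ent c a w x :=
    Finset.sum_congr rfl fun W hW => by rw [gValK_closeBE A pr (hbW W hW) hba hbw]
  have c5 : (∑ W ∈ U.powerset, prob pr (coreLevel arcs s U W) * gValK (closeB entb b A) pr ent c a w W *
      if m ∈ W then (1 : R) else 0) =
      ∑ W ∈ U.powerset, prob pr (coreLevel arcs s U W) * gValK (closeBE entb b A) pr ent c a w W *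
        if m ∈ W then (1 : R) else 0 :=
    Finset.sum_congr rfl fun W hW => by rw [gValK_closeBE A pr (hbW W hW) hba hbw]
  have c6 : ∑ x ∈ U.powerset, prob pr (coreLevel arcs s U x) * gValK (closeB entb b A) pr ent c a w x *
      entInd entb x =
      ∑ x ∈ U.powerset, prob pr (coreLevel arcs s U x) * gValK (closeBE entb b A) pr ent c a w x *
        entInd entb x :=
    Finset.sum_congr rfl fun W hW => by rw [gValK_closeBE A pr (hbW W hW) hba hbw]
  have c7 : (∑ W ∈ U.powerset, prob pr (coreLevel arcs s U W) * gValK (closeB entb b A) pr ent c a w W *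
      (entInd entb W * if m ∈ W then (1 : R) else 0)) =
      ∑ W ∈ U.powerset, prob pr (coreLevel arcs s U W) * gValK (closeBE entb b A) pr ent c a w W *
        ((if m ∈ W then (1 : R) else 0) * entInd entb W) :=
    Finset.sum_congr rfl fun W hW => by rw [gValK_closeBE A pr (hbW W hW) hba hbw]; ring
  rw [c1, c2, c3, c4, c5, c6, c7]
  obtain ⟨hA0, hAmono, hAlsm⟩ := OrTailU.head_props (U := insert a U) (a := b) pr hp hS t
  have hx0 : ∀ W : Finset V, (0 : R) ≤ (if m ∈ W then (1 : R) else 0) := by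
    intro W; split_ifs <;> norm_num
  have hxm : ∀ s t : Finset V,
      (if m ∈ s then (1 : R) else 0) ≤ (if m ∈ s ∪ t then (1 : R) else 0) := by
    intro s t
    by_cases hms : m ∈ s
    · rw [if_pos hms, if_pos (Finset.mem_union_left t hms)]
    · rw [if_neg hms]; split_ifs <;> norm_num
  exact orTailKSure_functional_nonneg_markers U (fun W => prob pr (coreLevel arcs s U W))
    (closeBE entb b A) pr ent c a w (fun W => if m ∈ W then (1 : R) else 0)
    (fun W => entInd entb W) hp.nonneg hp.le_one hsure (fun W => prob_nonneg hp _)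
    (fun s' hs' t' ht' => hν s' t' hs' ht') (closeBE_nonneg entb b A hA0)
    (closeBE_lsm entb b A hA0 hAlsm hAmono) (closeBE_mono entb b A hAmono)
    hx0 (fun W => entInd_nonneg entb W) hxm (fun s t => entInd_mono entb s t)

/-- **The mirror: markers `(b, m)`.** -/
theorem darc_of_orTailKSure_markerB' (pr : E → R) (hp : IsProbVec pr) (hS : SameEnds arcs)
    (h : OrTailK arcs s U ent c a) (hb : OrTailK arcs s (insert a U) entb d b) (hae : a ∉ entb)
    {m : V} (hm : m ∈ U) (hsure : ∀ r ∈ ent, pr (c r) = 1) (hsureb : ∀ r ∈ entb, pr (d r) = 1)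
    (hν : ∀ W W', W ⊆ U → W' ⊆ U →
      prob pr (coreLevel arcs s U W) * prob pr (coreLevel arcs s U W') ≤
        prob pr (coreLevel arcs s U (W ∩ W')) * prob pr (coreLevel arcs s U (W ∪ W')))
    {t : V} (htC : t ∉ insert b (insert a U)) (hts : t ≠ s) (hws : w ≠ s)
    (hwC : w ∉ insert b (insert a U)) :
    DARC pr arcs s {t} b m a w :=
  (darc_swap pr arcs s {t} m b a w).1
    (darc_of_orTailKSure_markerB pr hp hS h hb hae hm hsure hsureb hν htC hts hws hwC)

end MarkerB

end Summit.Ventures.PercRepro2.Coin
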